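import Mathlib.Analysis.Calculus.ContDiff.Basic
import Mathlib.Topology.UniformSpace.UniformConvergence
import Literature.Geometry.Lorentzian.KerrData
import Literature.Geometry.Lorentzian.KerrConvergence
import Literature.Geometry.Lorentzian.FinalState
import Literature.Geometry.Lorentzian.Geodesic
import HarnessLib

/-!
# Hintz's gluing of a small Kerr black hole into an initial data set, specialised to Kerr
# backgrounds and bound geodesics (EMRI data)  (family `gr`, summit `FinalStateConjecture`)

Definition request `defn-HintzGluedEMRIData` (route `GlobalAttraction`, item `EMRIFinalState`):
a Lean handle on "the one-parameter family of admissible one-ended vacuum data produced by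
Hintz's small-black-hole gluing, specialised to a Kerr background and a bound geodesic".

## Sources (read; page/theorem locators refer to the arXiv versions)

* P. Hintz, *Gluing small black holes into initial data sets*, Comm. Math. Phys. 405 (2024) 114 =
  arXiv:2210.13960 [Hintz2022]. **Thm. 1.1/1.2** (pp. 3, 8): given data `(X, γ, k)` with no KIDs in
  a connected neighbourhood `U°` of `p`, and `δ`-asymptotically flat data `(γ̂, k̂)` on `ℝⁿ ∖ K̂°`
  (`K̂` compact, *possibly empty*, p. 34), there are `ε♯ > 0` and constraint-solving data
  `(X_ε, γ_ε, k_ε)`, `0 < ε < ε♯`, with (1) `(γ_ε, k_ε) = (γ, k)` on `X ∖ U°`; (2) smooth convergence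
  to `(γ, k)` away from `p`; (3) in normal coordinates `x` at `p`, `(γ_ε, ε k_ε)|_{εx̂}(∂_x, ∂_x) →
  (γ̂, k̂)|_{x̂}` smoothly, locally uniformly in `x̂ ∈ ℝⁿ ∖ K̂°`. **Thm. 5.2** (pp. 56–57, detailed
  version: a polyhomogeneous total family; (2) equality near `X̃ ∖ ([0,1) × U°)`; (3) the
  constraints hold on every `ε`-level set for `ε < ε♯`). **Lemma 6.1** (p. 65, *boosted Kerr
  initial data*: the data induced by Kerr on a spacelike hypersurface which for large `r` is a
  level set of a boosted time coordinate `t_w`, read in the boosted Cartesian coordinates `x_w`,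
  are `E`-asymptotically flat, `E = ℕ₀ + 1`). **Thm. 6.2** (p. 66, *Kerr background*, which has
  KIDs: for exact subextremal Kerr data on the horizon-penetrating slice
  `X_{2η} = {t = 0, r > r_e − 2η}`, `p` in the exterior, `U° ∋ p` connected with compact closure
  disjoint from `{r = r_e − 2η}` and meeting the collar `X_{2η} ∖ X_η`, the conclusions of Thm. 5.2
  hold on `X̃_η`, i.e. the glued data solve the constraints on `X_η = {r > r_e − η}`; the cokernel
  is disposed of by violating the constraints deep inside the black hole, `r < r_e − η`).
* P. Hintz, *Gluing small black holes along timelike geodesics I–III*, arXiv:2306.07409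
  [Hintz2023GluingI] (Thm. 1.1, §1.2, Thm. 5.4, Thm. 11.1, Thm. 12.1: formal spacetime gluing of a
  mass-`εm̂` Kerr hole along a timelike geodesic `C` with velocity `v` at `p = X ∩ C`; the data of
  the glued metrics at `X` solve the constraints and "describe a Kerr initial data set glued into
  the initial data of `(M, g)` at `X`", p. 10), arXiv:2408.06712 [Hintz2024GluingII],
  arXiv:2408.06715 [Hintz2024GluingIII] (Thm. 1.1: true solutions on compact subsets; Thm. 6.1 /
  Rem. 6.2: extreme-mass-ratio *mergers* along horizon-crossing geodesics; p. 3: "When `(M, g)` is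
  a Kerr black hole and `C` is a bound orbit, the gluing construction … is significantly more
  challenging" — along a bound orbit the spacetime gluing is available only over compact subsets
  of the background (Thm. 1.1), not uniformly over the radiation-reaction time `∼ ε⁻¹`; at the
  level of initial data the bound case is an instance of [Hintz2022]).

## What is defined (namespace `Literature.Geometry.Lorentzian`)

* Coordinate readings `InitialDataSet.coordH/coordK` (data on `E3`) and `coordHOn/coordKOn`
  (data on an open subset of `E3`, junk `0` outside), the blow-up
  `HintzGluing.blowup F p L ε x̂ = F(p + ε L x̂)(L ·, L ·)` (components of a tensor at the point
  `p + ε L x̂` on the frame `L`; this is Hintz's `(γ_ε|_{εx̂}(∂_{xⁱ}, ∂_{xʲ}))` with the affine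
  coordinates `x̂ ↦ p + ε L x̂` in place of normal coordinates — the two agree to first order at `p`
  when `L` is `h(p)`-orthonormal, so the rescaled limits coincide), and `C^∞_loc`-convergence as
  `ε → 0⁺`, `HintzGluing.SmoothlyConvergesOn`.
* `Kerr.EmbeddedPatch M a r₁ hM D W` — *`D` is exactly Kerr on the open set `W`*: a smooth
  embedding of `W` into the ingoing Kerr–Schild chart `Kerr.region a r₁` of `g_{M,a}` as a
  spacelike hypersurface with future unit normal whose induced first and second fundamental forms
  are `(h, k)|_W` (the idiom of `DataEmbedding.induced_h/induced_k`). Any slice of Kerr is allowed: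
  the Kerr–Schild slices themselves are **not** strongly asymptotically flat in the
  Dafermos–Rodnianski sense (`Kerr.not_isStronglyAsymptoticallyFlatDR_data`, `KerrData.lean`), so a
  background that is to lie in `admissibleVacuumData E3` must be Kerr along an asymptotically
  Boyer–Lindquist slice near infinity; the patch does not pin the slice.
* `Kerr.BoostedFarPatch m̂ â hm Λ R D̂` — *boosted Kerr initial data* (Lemma 6.1 of [Hintz2022]):
  outside the ball of radius `R`, `D̂` is the datum induced by `g_{m̂,â}` on the boosted hyperplane
  `x ↦ Λ⁻¹(0, x)` (`Λ ∈ O(1,3)`, `lorentzGroup` of `KerrConvergence.lean`), and this patch covers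
  the whole closed-exterior part `{r ≥ r₊(m̂, â)}` of the hyperplane (so it penetrates the horizon
  of the small hole; for `0 ≤ m̂` every `η`-spacelike hyperplane is `g_{m̂,â}`-spacelike, since
  `g = η + 2H ℓ ⊗ ℓ` with `H ≥ 0`). Inside the ball `D̂` is unrestricted (a regular core: we take
  Hintz's `K̂ = ∅`, so that glued data live on the whole background manifold).
* `Kerr.IsBoundGeodesicVelocity M a r₁ q u` — `u ∈ T_q` is a future unit timelike vector and the
  `g_{M,a}`-geodesic through `(q, u)` is defined on `ℝ` with Kerr–Schild radius confined to a
  compact sub-interval of `(r₊, ∞)` (a bound, non-plunging, non-escaping orbit).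
* `HintzGluing.IsGluedFamily D₀ p L D̂ ε₀ D` — the shape of the conclusions (1)–(3) of
  [Hintz2022, Thm. 1.1] for data on `E3` with `K̂ = ∅`: joint smoothness in `(ε, y)` on
  `(0, ε₀) × E3`; `D ε = D₀` outside an `ε`-independent compact set; `C^∞_loc` convergence to `D₀`
  on `E3 ∖ {p}`; blow-ups at `p` through `L` converge in `C^∞_loc(E3)` to `D̂` (with the factor `ε`
  on `k`, loc. cit. (3) and footnote 1).
* `IsHintzGluedEMRIFamily M a D₀ p u D` — **the requested notion** (signature of the request):
  `(M, a)` subextremal; `D₀ ∈ admissibleVacuumData E3` exactly Kerr (`Kerr.EmbeddedPatch`) on an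
  open set containing `p` and the complement of a compact set not containing `p`, the patch
  reaching inside the event horizon, `r(ι p) > r₊`; `u` the velocity of a bound geodesic at `ι p`;
  and `D` an `IsGluedFamily` at `p` whose members are admissible and whose rescaled limit `D̂` is a
  boosted Kerr datum with subextremal parameters `(m̂, â)` and boost `Λ` **consistent with `u`**:
  writing `û = Λ e₀` (the small hole's asymptotic rest velocity in the frame of the model slice,
  `Λ` orthochronous), `u = û⁰ ν_p + dι_p(L û⃗)` where `ν_p` is the background slice normal and
  `(dι_p L eᵢ)` the tangent frame at `ι p` — the blow-up of the background slice at `p` is the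
  hyperplane `ν_p^⊥`, which in the rest frame of a hole moving with 4-velocity `u` is the boosted
  hyperplane `{(Λz)⁰ = 0}` ([Hintz2022], abstract and §1.4: "appropriate boosted Kerr initial data
  sets … conjecturally evolve into the extreme mass ratio inspiral"; [Hintz2023GluingI], Thm. 1.1
  (2): near `C` the glued metric is the Kerr metric at rest in Fermi coordinates along `C`).
  `HintzGluedEMRIData M a D₀ p u` is the set of such families (the notion's name; the gluing is
  not unique, so it is a class, not a chosen function `ε ↦ D_ε`).

## Honest gap (why this file states no existence fact)

[Hintz2022] proves existence of glued families either for backgrounds WITHOUT KIDs near `p`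
(Thm. 5.2; KIDs — the kernel of the formal adjoint of the linearised constraint map — are not in
the tree, so this hypothesis cannot be stated here), or for the EXACT Kerr slice with the
obstruction pushed inside the black hole (Thm. 6.2; its families live on the Kerr–Schild slice
`Kerr.slice a (r₊ − η)`, a manifold with an incomplete inner end, hence not in
`admissibleVacuumData`; that theorem is vendored separately, in the companion file
`HintzKerrSliceGluing.lean` of this directory, over `Kerr.data` of `KerrData.lean` and the helpers
below). A background as in `IsHintzGluedEMRIFamily` (regular vacuum core + exact Kerr outside) is
exactly Kerr near `p` and therefore HAS local KIDs at `p`; Thm. 5.2 applies to it only with a `U°`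
reaching into a KID-free core. No published statement covers this configuration verbatim, so
none is vendored (D-0026); the item `EMRIFinalState` quantifies over families satisfying the
predicate.

## Mathlib

No Lorentzian geometry, initial data or Kerr metric in Mathlib; used: `ContinuousLinearMap.
bilinearComp`, `iteratedFDeriv`, `TendstoUniformlyOn`, `ContDiffOn`, `Manifold.IsSmoothEmbedding`,
`mfderiv`. Everything else is the tree's (`KerrSchild`, `KerrData`, `KerrConvergence`,
`Hypersurface`, `Isometry`, `InitialData`, `FinalState`, `Geodesic`).
-/

noncomputable section

open Bundle Set Filter TopologicalSpace Manifold Function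
open scoped Manifold ContDiff Topology

namespace Literature.Geometry.Lorentzian

/-! ### Coordinate readings of initial data on `E3` and on open subsets of `E3` -/

namespace InitialDataSet

/-- The metric `h` of data on `E3 = ℝ³`, read as a coefficient map `E3 → (E3 →L E3 →L ℝ)`
(`T_y E3 = E3` definitionally): `coordH D y (v, w) = h_y(v, w)`, i.e. the matrix
`h_y(∂_i, ∂_j)` of Hintz, arXiv:2210.13960, Thm. 1.1 (2). [cite: Hintz2022, Thm. 1.1] -/
def coordH (D : InitialDataSet (𝓡 3) E3) (y : E3) : E3 →L[ℝ] E3 →L[ℝ] ℝ :=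
  D.h.inner y

/-- The tensor `k` of data on `E3`, read as a coefficient map (`k_y(∂_i, ∂_j)`, Hintz,
arXiv:2210.13960, Thm. 1.1 (2)). [cite: Hintz2022, Thm. 1.1] -/
def coordK (D : InitialDataSet (𝓡 3) E3) (y : E3) : E3 →L[ℝ] E3 →L[ℝ] ℝ :=
  D.k y

/-- Unfolding lemma for `coordH`. [folklore] -/
@[simp]
theorem coordH_apply (D : InitialDataSet (𝓡 3) E3) (y v w : E3) :
    D.coordH y v w = D.h.inner y v w := rfl

/-- Unfolding lemma for `coordK`. [folklore] -/
@[simp]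
theorem coordK_apply (D : InitialDataSet (𝓡 3) E3) (y v w : E3) :
    D.coordK y v w = D.k y v w := rfl

variable {U : Opens E3}

open Classical in
/-- The metric of data on an open subset `U ⊆ E3`, read as a coefficient map on `E3` (junk
value `0` outside `U`; `T_y U = E3` definitionally). Hintz, arXiv:2210.13960, Thm. 1.1 (2).
[cite: Hintz2022, Thm. 1.1] -/
def coordHOn (D : InitialDataSet 𝓘(ℝ, E3) U) (y : E3) : E3 →L[ℝ] E3 →L[ℝ] ℝ :=
  if hy : y ∈ U then (show E3 →L[ℝ] E3 →L[ℝ] ℝ from D.h.inner ⟨y, hy⟩) else 0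

open Classical in
/-- The tensor `k` of data on an open subset `U ⊆ E3`, read as a coefficient map on `E3` (junk
value `0` outside `U`). Hintz, arXiv:2210.13960, Thm. 1.1 (2). [cite: Hintz2022, Thm. 1.1] -/
def coordKOn (D : InitialDataSet 𝓘(ℝ, E3) U) (y : E3) : E3 →L[ℝ] E3 →L[ℝ] ℝ :=
  if hy : y ∈ U then (show E3 →L[ℝ] E3 →L[ℝ] ℝ from D.k ⟨y, hy⟩) else 0

/-- On `U` the reading `coordHOn` is the metric. [folklore] -/
theorem coordHOn_of_mem (D : InitialDataSet 𝓘(ℝ, E3) U) {y : E3} (hy : y ∈ U) :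
    D.coordHOn y = (show E3 →L[ℝ] E3 →L[ℝ] ℝ from D.h.inner ⟨y, hy⟩) := by
  simp [coordHOn, hy]

/-- On `U` the reading `coordKOn` is the tensor `k`. [folklore] -/
theorem coordKOn_of_mem (D : InitialDataSet 𝓘(ℝ, E3) U) {y : E3} (hy : y ∈ U) :
    D.coordKOn y = (show E3 →L[ℝ] E3 →L[ℝ] ℝ from D.k ⟨y, hy⟩) := by
  simp [coordKOn, hy]

/-- Outside `U` the reading `coordHOn` is the junk value `0`. [folklore] -/
theorem coordHOn_of_not_mem (D : InitialDataSet 𝓘(ℝ, E3) U) {y : E3} (hy : y ∉ U) :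
    D.coordHOn y = 0 := by
  simp [coordHOn, hy]

end InitialDataSet

/-! ### Blow-up at a point through a frame, and `C^∞_loc` convergence as `ε → 0⁺` -/

namespace HintzGluing

/-- The **blow-up at `p` through the frame `L` at scale `ε`** of a field `F` of bilinear forms
on `E3`: `blowup F p L ε x̂ = F(p + ε L x̂)(L ·, L ·)`, the components of `F` at the point with
affine coordinates `x̂` (centred at `p`, axes `L eᵢ`, unit `ε`) on the frame `(L eᵢ)`. For
`F = h` resp. `F = k` of glued data this is `γ_ε|_{εx̂}(∂_{xⁱ}, ∂_{xʲ})` resp.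
`k_ε|_{εx̂}(∂_{xⁱ}, ∂_{xʲ})` of Hintz, arXiv:2210.13960, Thm. 1.1 (3), with affine instead of
geodesic normal coordinates (same rescaled limits when `L` is `h(p)`-orthonormal).
[cite: Hintz2022, Thm. 1.1 (3)] -/
def blowup (F : E3 → E3 →L[ℝ] E3 →L[ℝ] ℝ) (p : E3) (L : E3 →L[ℝ] E3) (ε : ℝ) (x : E3) :
    E3 →L[ℝ] E3 →L[ℝ] ℝ :=
  (F (p + ε • L x)).bilinearComp L L

/-- Unfolding lemma: `blowup F p L ε x̂ v w = F(p + ε L x̂)(L v, L w)`. [cite: Hintz2022, Thm. 1.1 (3)] -/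
@[simp]
theorem blowup_apply (F : E3 → E3 →L[ℝ] E3 →L[ℝ] ℝ) (p : E3) (L : E3 →L[ℝ] E3) (ε : ℝ)
    (x v w : E3) : blowup F p L ε x v w = F (p + ε • L x) (L v) (L w) := rfl

/-- At scale `ε = 0` the blow-up is the constant field `F(p)(L ·, L ·)`. [folklore] -/
theorem blowup_zero (F : E3 → E3 →L[ℝ] E3 →L[ℝ] ℝ) (p : E3) (L : E3 →L[ℝ] E3) (x : E3) :
    blowup F p L 0 x = (F p).bilinearComp L L := by
  simp [blowup]

variable {G : Type*} [NormedAddCommGroup G] [NormedSpace ℝ G]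

/-- **`C^∞_loc` convergence as `ε → 0⁺` on the set `S ⊆ E3`**: for every order `n` and every
compact `C ⊆ S`, the `n`-th derivatives of `F ε` converge to those of `F₀` uniformly on `C` as
`ε ↘ 0` ("smoothly and locally uniformly", Hintz, arXiv:2210.13960, Thm. 1.1 (2)–(3)).
[cite: Hintz2022, Thm. 1.1 (2)–(3)] -/
def SmoothlyConvergesOn (F : ℝ → E3 → G) (F₀ : E3 → G) (S : Set E3) : Prop :=
  ∀ (n : ℕ) (C : Set E3), IsCompact C → C ⊆ S →
    TendstoUniformlyOn (fun ε ↦ iteratedFDeriv ℝ n (F ε)) (iteratedFDeriv ℝ n F₀)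
      (𝓝[>] (0 : ℝ)) C

/-- `C^∞_loc` convergence on `S` restricts to subsets of `S`. [folklore] -/
theorem SmoothlyConvergesOn.mono {F : ℝ → E3 → G} {F₀ : E3 → G} {S S' : Set E3}
    (h : SmoothlyConvergesOn F F₀ S) (hS : S' ⊆ S) : SmoothlyConvergesOn F F₀ S' :=
  fun n C hC hCS ↦ h n C hC (hCS.trans hS)

/-- `C^∞_loc` convergence on `S` is a property of the compact subsets of `S`: it holds on `S` as
soon as it holds on every compact `C ⊆ S`. [folklore] -/
theorem SmoothlyConvergesOn.of_forall_subset {F : ℝ → E3 → G} {F₀ : E3 → G} {S : Set E3}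
    (h : ∀ C : Set E3, IsCompact C → C ⊆ S → SmoothlyConvergesOn F F₀ C) :
    SmoothlyConvergesOn F F₀ S :=
  fun n C hC hCS ↦ h C hC hCS n C hC subset_rfl

end HintzGluing

/-! ### "Exactly Kerr on an open set": embedded Kerr patches -/

namespace Kerr

variable [Facts] [SliceFacts]

/-- **The data `D` on `E3` are exactly Kerr on the open set `W`:** a realisation of `(h, k)|_W`
as the data induced on a spacelike hypersurface of the Kerr spacetime `(Kerr.region a r₁,
g_{M,a})` (ingoing Kerr–Schild chart with inner radius `r₁`, `Kerr.smoothMetric`, time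
orientation `Kerr.timeOrientation`, `0 ≤ M`): a smooth embedding `ι : W → Kerr.region a r₁`
with a future unit normal field `ν` along it such that `ι^* g = h|_W` and `K_ν = k|_W` (sign
convention `K_ν(v, w) = + g(D_v ν, dι w)`, as in `InitialDataSet` and `DataEmbedding`). Which
slice of Kerr is used is not fixed (Kerr–Schild, asymptotically Boyer–Lindquist, …). This is the
hypothesis "`(γ, k)` are K(AdS) data" of Hintz, arXiv:2210.13960, §6.2, localised to `W`.
[cite: Hintz2022, §6.2] -/
structure EmbeddedPatch (M a r₁ : ℝ) (hM : 0 ≤ M) (D : InitialDataSet (𝓡 3) E3)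
    (W : Opens E3) where
  /-- The embedding `ι : W → Kerr.region a r₁`. -/
  embed : W → region a r₁
  /-- The future unit normal field along `ι`. -/
  normal : NormalField 𝓘(ℝ, E4) embed
  /-- `ι` is a smooth embedding. -/
  isSmoothEmbedding : Manifold.IsSmoothEmbedding (𝓡 3) 𝓘(ℝ, E4) ∞ embed
  /-- `ν` is the future unit normal of `ι` in `(Kerr.region a r₁, g_{M,a}, −g♯dt*)`. -/
  isFutureUnitNormal : (smoothMetric M a r₁).IsFutureUnitNormal (𝓡 3)
    ((timeOrientation M a r₁ hM).ofLE le_top) embed normal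
  /-- The induced metric is `h|_W`. -/
  induced_h : ∀ y : W, (smoothMetric M a r₁).inducedBilin (𝓡 3) embed y =
    (show E3 →L[ℝ] E3 →L[ℝ] ℝ from D.h.inner (y : E3))
  /-- The second fundamental form w.r.t. `ν` is `k|_W`. -/
  induced_k : ∀ y : W, (smoothMetric M a r₁).secondFundamentalForm (𝓡 3) embed normal y =
    (show LinearMap.BilinForm ℝ E3 from D.kBilin (y : E3))

/-- **Boosted Kerr initial data with a core** (Hintz, arXiv:2210.13960, Lemma 6.1, with
`K̂ = ∅`): the datum `D̂` on `E3` is, outside the closed ball of radius `R`, the datum induced by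
the Kerr metric `g_{m̂,â}` (`0 ≤ m̂`) on the **boosted hyperplane** `x ↦ Λ⁻¹(0, x)` of the
ingoing Kerr–Schild chart, `Λ ∈ O(1,3)` (`lorentzGroup`), read in the boosted Cartesian
coordinates `x` ("identify `Σ` with `ℝ³` via `x_w` for large `r`", loc. cit.); and the patch
covers every point of that hyperplane in the closed exterior `{r ≥ r₊(m̂, â)}`, so that it
crosses the event horizon of the small hole. Inside the ball `D̂` is an arbitrary (regular)
core. [cite: Hintz2022, Lemma 6.1] -/
structure BoostedFarPatch (m a r₁ : ℝ) (hm : 0 ≤ m) (Λ : lorentzGroup) (R : ℝ)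
    (D : InitialDataSet (𝓡 3) E3) where
  /-- The Kerr patch of `D̂` on `{‖x‖ > R}`. -/
  patch : EmbeddedPatch m a r₁ hm D (exteriorRegion R)
  /-- The patch is the boosted hyperplane `x ↦ Λ⁻¹(0, x)`. -/
  embed_eq : ∀ x : exteriorRegion R,
    (patch.embed x : E4) = (Λ : E4 ≃L[ℝ] E4).symm (E4.ofTimeSpace 0 x)
  /-- The patch covers the closed-exterior part of the hyperplane. -/
  covers : ∀ x : E3,
    rPlus m a ≤ radius a ((Λ : E4 ≃L[ℝ] E4).symm (E4.ofTimeSpace 0 x)) → R < ‖x‖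

/-- **`u` is the velocity of a bound timelike geodesic of Kerr at `q`**: `u ∈ T_q` is a future
directed unit timelike vector of `g_{M,a}` and the geodesic of the Levi-Civita connection of
`g_{M,a}` with initial data `(q, u)` is defined on all of `ℝ` with Kerr–Schild radius confined to
a compact sub-interval `[r_min, r_max]` of `(r₊, ∞)` (it neither plunges nor escapes: a bound
orbit, e.g. one with `E < 1` oscillating between its radial turning points; O'Neill 1995, Ch. 4
(Kerr geodesics: first integrals `E`, `L`, `Q` and the radial motion)). Hintz,
arXiv:2408.06715, p. 3 ("`C` is a bound orbit"). [cite: Hintz2024GluingIII, p. 3] -/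
def IsBoundGeodesicVelocity (M a r₁ : ℝ) (hM : 0 ≤ M) (q : region a r₁) (u : E4) : Prop :=
  (smoothMetric M a r₁).val q u u = -1 ∧
    ((timeOrientation M a r₁ hM).ofLE (le_top : (∞ : ℕ∞ω) ≤ ω)).IsFutureDirected
      (show TangentSpace 𝓘(ℝ, E4) q from u) ∧
    ∃ γ : ℝ → region a r₁, IsGeodesic (smoothMetric M a r₁).leviCivita γ ∧ γ 0 = q ∧
      velocity 𝓘(ℝ, E4) γ 0 = u ∧
      ∃ rmin rmax : ℝ, rPlus M a < rmin ∧
        ∀ s : ℝ, rmin ≤ radius a (γ s) ∧ radius a (γ s) ≤ rmax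

/-- A bound geodesic velocity is a unit timelike vector. [cite: Hintz2024GluingIII, p. 3] -/
theorem IsBoundGeodesicVelocity.val_self {M a r₁ : ℝ} {hM : 0 ≤ M} {q : region a r₁} {u : E4}
    (h : IsBoundGeodesicVelocity M a r₁ hM q u) : (smoothMetric M a r₁).val q u u = -1 :=
  h.1

end Kerr

/-! ### The shape of a Hintz-glued family of data on `E3` -/

namespace HintzGluing

/-- **Hintz-glued family on `E3`** (the conclusions (1)–(3) of Hintz, arXiv:2210.13960, Thm. 1.1
/ Thm. 5.2, for a background `D₀` on `X = E3` and a model `D̂` on all of `E3`, i.e. `K̂ = ∅`, so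
that `X_ε = X`): for the parameters `0 < ε < ε₀`,
* the family is jointly smooth in `(ε, y) ∈ (0, ε₀) × E3` (a polyhomogeneous total family is
  smooth in the interior);
* (1) there is an `ε`-independent compact set outside which `D ε = D₀` exactly;
* (2) `D ε → D₀` in `C^∞_loc(E3 ∖ {p})` as `ε ↘ 0`;
* (3) the blow-ups at `p` through the frame `L` converge in `C^∞_loc(E3)`:
  `h_ε(p + εLx̂)(L·, L·) → ĥ(x̂)` and `ε · k_ε(p + εLx̂)(L·, L·) → k̂(x̂)` (the factor `ε` on `k`
  is loc. cit. (3), footnote 1).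
Nothing is said about `ε ∉ (0, ε₀)`. [cite: Hintz2022, Thm. 1.1 and Thm. 5.2] -/
structure IsGluedFamily (D₀ : InitialDataSet (𝓡 3) E3) (p : E3) (L : E3 →L[ℝ] E3)
    (Dhat : InitialDataSet (𝓡 3) E3) (ε₀ : ℝ) (D : ℝ → InitialDataSet (𝓡 3) E3) : Prop where
  /-- The parameter range `(0, ε₀)` is nonempty. -/
  ε₀_pos : 0 < ε₀
  /-- `(ε, y) ↦ h_ε(y)` is jointly smooth on `(0, ε₀) × E3`. -/
  contDiffOn_h : ContDiffOn ℝ ∞ (fun q : ℝ × E3 ↦ (D q.1).coordH q.2) (Ioo 0 ε₀ ×ˢ univ)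
  /-- `(ε, y) ↦ k_ε(y)` is jointly smooth on `(0, ε₀) × E3`. -/
  contDiffOn_k : ContDiffOn ℝ ∞ (fun q : ℝ × E3 ↦ (D q.1).coordK q.2) (Ioo 0 ε₀ ×ˢ univ)
  /-- (1) `D ε = D₀` outside an `ε`-independent compact set. -/
  exists_eq_of_not_mem : ∃ C : Set E3, IsCompact C ∧ ∀ ε ∈ Ioo 0 ε₀, ∀ y ∉ C,
    (D ε).coordH y = D₀.coordH y ∧ (D ε).coordK y = D₀.coordK y
  /-- (2) `h_ε → h₀` in `C^∞_loc(E3 ∖ {p})`. -/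
  converges_h : SmoothlyConvergesOn (fun ε ↦ (D ε).coordH) D₀.coordH {p}ᶜ
  /-- (2) `k_ε → k₀` in `C^∞_loc(E3 ∖ {p})`. -/
  converges_k : SmoothlyConvergesOn (fun ε ↦ (D ε).coordK) D₀.coordK {p}ᶜ
  /-- (3) `h_ε(p + εLx̂)(L·, L·) → ĥ(x̂)` in `C^∞_loc(E3)`. -/
  blowup_h : SmoothlyConvergesOn (fun ε ↦ blowup (D ε).coordH p L ε) Dhat.coordH univ
  /-- (3) `ε k_ε(p + εLx̂)(L·, L·) → k̂(x̂)` in `C^∞_loc(E3)`. -/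
  blowup_k : SmoothlyConvergesOn (fun ε ↦ ε • blowup (D ε).coordK p L ε) Dhat.coordK univ

/-- Members of a glued family agree with the background outside a fixed compact set.
[cite: Hintz2022, Thm. 1.1 (1)] -/
theorem IsGluedFamily.exists_isCompact {D₀ : InitialDataSet (𝓡 3) E3} {p : E3} {L : E3 →L[ℝ] E3}
    {Dhat : InitialDataSet (𝓡 3) E3} {ε₀ : ℝ} {D : ℝ → InitialDataSet (𝓡 3) E3}
    (h : IsGluedFamily D₀ p L Dhat ε₀ D) :
    ∃ C : Set E3, IsCompact C ∧ ∀ ε ∈ Ioo 0 ε₀, ∀ y ∉ C, (D ε).coordH y = D₀.coordH y :=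
  let ⟨C, hC, hCeq⟩ := h.exists_eq_of_not_mem
  ⟨C, hC, fun ε hε y hy ↦ (hCeq ε hε y hy).1⟩

end HintzGluing

/-! ### The requested notion: Hintz-glued EMRI data on `ℝ³` -/

section EMRI

variable [Kerr.Facts] [Kerr.SliceFacts]

/-- **Hintz-glued EMRI family** (`defn-HintzGluedEMRIData`; Hintz, arXiv:2210.13960, Thm. 1.1 and
§§1.4, 6; arXiv:2306.07409, Thm. 1.1 and §1.2; arXiv:2408.06715, §6). The family
`D : ℝ → InitialDataSet (𝓡 3) E3` (meaningful for `0 < ε < ε₀`) arises from the background `D₀`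
by gluing a small subextremal Kerr black hole at the point `p` with 4-velocity `u`, on the Kerr
background `(M, a)`, along a bound geodesic:
* **background**: `(M, a)` is subextremal; `D₀ ∈ admissibleVacuumData E3` (regular one-ended
  vacuum datum on `ℝ³`); `D₀` is exactly Kerr `(M, a)` (`Kerr.EmbeddedPatch`, inner chart radius
  `r₁`) on an open set `W` containing `p` and the complement `Kᶜ` of a compact set `K ∌ p` (the
  "collapsing core"), the patch reaching inside the event horizon (`r(ι y) < r₊` for some `y`),
  and `r(ι p) > r₊` (the gluing point is in the exterior);
* **orbit**: `u ∈ T_{ι p}` is the velocity of a bound timelike geodesic of `g_{M,a}`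
  (`Kerr.IsBoundGeodesicVelocity`);
* **small hole**: there are subextremal `(m̂, â)`, an orthochronous `Λ ∈ O(1,3)`, a radius `R`,
  a model datum `D̂` on `E3` which is boosted Kerr `(m̂, â, Λ)` outside the ball of radius `R`
  (`Kerr.BoostedFarPatch`), and a frame `L` at `p`, `h₀(p)`-orthonormal, such that the boost is
  **the one seen from the background slice**: with `û = Λ e₀` (the hole's asymptotic rest
  velocity in the frame of the model slice `{(Λz)⁰ = 0}`),
  `u = û⁰ ν_p + dι_p (L û⃗)`, `ν_p` the future unit normal and `dι_p ∘ L` the tangent frame of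
  the background patch at `ι p`;
* **family**: `D` is a Hintz-glued family at `p` with background `D₀`, frame `L`, model `D̂`
  (`HintzGluing.IsGluedFamily`: jointly smooth; `= D₀` outside a fixed compact set; `→ D₀` in
  `C^∞_loc(E3 ∖ {p})`; blow-ups `→ D̂`, i.e. near `p` the member `D ε` is, at scale `ε`, the
  boosted Kerr datum of mass `ε m̂` and specific angular momentum `ε â`), and every member
  `D ε`, `0 < ε < ε₀`, lies in `admissibleVacuumData E3`.
Existence of such families is NOT vendored (module docstring, "Honest gap"): the published
existence theorems need either a KID-free neighbourhood of `p` (Thm. 5.2) or the exact Kerr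
slice with violations inside the hole (Thm. 6.2, companion file `HintzKerrSliceGluing.lean`).
[cite: Hintz2022, Thm. 1.1, Lemma 6.1, Thm. 6.2] [cite: Hintz2023GluingI, Thm. 1.1 and §1.2] -/
def IsHintzGluedEMRIFamily (M a : ℝ) (D₀ : InitialDataSet (𝓡 3) E3) (p : E3) (u : E4)
    (D : ℝ → InitialDataSet (𝓡 3) E3) : Prop :=
  ∃ (hMa : Kerr.IsSubextremal M a) (r₁ : ℝ) (W : Opens E3) (hp : p ∈ W)
    (P : Kerr.EmbeddedPatch M a r₁ hMa.pos.le D₀ W) (K : Set E3),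
    -- background
    D₀ ∈ admissibleVacuumData E3 ∧ IsCompact K ∧ Kᶜ ⊆ (W : Set E3) ∧ p ∉ K ∧
    (∃ y : W, Kerr.radius a (P.embed y) < Kerr.rPlus M a) ∧
    Kerr.rPlus M a < Kerr.radius a (P.embed ⟨p, hp⟩) ∧
    -- orbit
    Kerr.IsBoundGeodesicVelocity M a r₁ hMa.pos.le (P.embed ⟨p, hp⟩) u ∧
    -- small hole, frame, family
    ∃ (m â rc R : ℝ) (hm : Kerr.IsSubextremal m â) (Λ : lorentzGroup)
      (Dhat : InitialDataSet (𝓡 3) E3) (_B : Kerr.BoostedFarPatch m â rc hm.pos.le Λ R Dhat)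
      (L : E3 →L[ℝ] E3) (ε₀ : ℝ),
      (∀ v w : E3, D₀.h.inner p (L v) (L w) = inner ℝ v w) ∧
      0 < (Λ : E4 ≃L[ℝ] E4) (E4.basisVector 0) 0 ∧
      u = ((Λ : E4 ≃L[ℝ] E4) (E4.basisVector 0) 0) • (show E4 from P.normal ⟨p, hp⟩) +
        (show E3 →L[ℝ] E4 from mfderiv (𝓡 3) 𝓘(ℝ, E4) P.embed ⟨p, hp⟩)
          (L (E4.spatial ((Λ : E4 ≃L[ℝ] E4) (E4.basisVector 0)))) ∧
      HintzGluing.IsGluedFamily D₀ p L Dhat ε₀ D ∧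
      ∀ ε ∈ Ioo 0 ε₀, D ε ∈ admissibleVacuumData E3

/-- **Hintz-glued EMRI data** (the requested notion `HintzGluedEMRIData`): the class of
one-parameter families `D : ℝ → InitialDataSet (𝓡 3) E3` of admissible one-ended vacuum data on
`ℝ³` produced by Hintz's small-black-hole gluing on the Kerr background `(M, a)` with regular core
`D₀`, at the exterior point `p`, with the 4-velocity `u` of a bound geodesic — i.e. the families
satisfying `IsHintzGluedEMRIFamily M a D₀ p u`. A set (possibly empty for bad parameters; see the
module docstring, "Honest gap", for what is and is not a published existence theorem), not a
chosen function `ε ↦ D_ε`: the gluing is not unique. Hintz, arXiv:2210.13960, Thm. 1.1 and §6;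
arXiv:2306.07409, Thm. 1.1 and §1.2. [cite: Hintz2022, Thm. 1.1 and §6] -/
def HintzGluedEMRIData (M a : ℝ) (D₀ : InitialDataSet (𝓡 3) E3) (p : E3) (u : E4) :
    Set (ℝ → InitialDataSet (𝓡 3) E3) :=
  {D | IsHintzGluedEMRIFamily M a D₀ p u D}

variable {M a : ℝ} {D₀ : InitialDataSet (𝓡 3) E3} {p : E3} {u : E4}
  {D : ℝ → InitialDataSet (𝓡 3) E3}

/-- Membership in `HintzGluedEMRIData` is the predicate `IsHintzGluedEMRIFamily` (by `rfl`).
[cite: Hintz2022, Thm. 1.1 and §6] -/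
@[simp]
theorem mem_hintzGluedEMRIData_iff :
    D ∈ HintzGluedEMRIData M a D₀ p u ↔ IsHintzGluedEMRIFamily M a D₀ p u D :=
  Iff.rfl

/-- The background parameters of a Hintz-glued EMRI family are subextremal.
[cite: Hintz2022, Thm. 6.2] -/
theorem IsHintzGluedEMRIFamily.isSubextremal (h : IsHintzGluedEMRIFamily M a D₀ p u D) :
    Kerr.IsSubextremal M a :=
  h.1

/-- The background of a Hintz-glued EMRI family is admissible. [cite: Hintz2022, Thm. 1.1] -/
theorem IsHintzGluedEMRIFamily.mem_admissibleVacuumData (h : IsHintzGluedEMRIFamily M a D₀ p u D) :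
    D₀ ∈ admissibleVacuumData E3 := by
  obtain ⟨_, _, _, _, _, _, hD₀, _⟩ := h
  exact hD₀

/-- The members of a Hintz-glued EMRI family are admissible for all small `ε > 0`, and agree with
the background outside a fixed compact set. [cite: Hintz2022, Thm. 1.1 (1)] -/
theorem IsHintzGluedEMRIFamily.exists_forall_mem (h : IsHintzGluedEMRIFamily M a D₀ p u D) :
    ∃ ε₀ : ℝ, 0 < ε₀ ∧ (∀ ε ∈ Ioo 0 ε₀, D ε ∈ admissibleVacuumData E3) ∧
      ∃ C : Set E3, IsCompact C ∧ ∀ ε ∈ Ioo 0 ε₀, ∀ y ∉ C, (D ε).coordH y = D₀.coordH y := by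
  obtain ⟨_, _, _, _, _, _, _, _, _, _, _, _, _, _, _, _, _, _, _, _, _, _, ε₀, _, _, _, hfam,
    hadm⟩ := h
  exact ⟨ε₀, hfam.ε₀_pos, hadm, hfam.exists_isCompact⟩

/-- The velocity parameter of a Hintz-glued EMRI family is the velocity of a bound Kerr geodesic
at the image of the gluing point. [cite: Hintz2024GluingIII, p. 3] -/
theorem IsHintzGluedEMRIFamily.exists_isBoundGeodesicVelocity
    (h : IsHintzGluedEMRIFamily M a D₀ p u D) :
    ∃ (hMa : Kerr.IsSubextremal M a) (r₁ : ℝ) (W : Opens E3) (hp : p ∈ W)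
      (P : Kerr.EmbeddedPatch M a r₁ hMa.pos.le D₀ W),
      Kerr.IsBoundGeodesicVelocity M a r₁ hMa.pos.le (P.embed ⟨p, hp⟩) u := by
  obtain ⟨hMa, r₁, W, hp, P, _, _, _, _, _, _, _, hu, _⟩ := h
  exact ⟨hMa, r₁, W, hp, P, hu⟩

end EMRI

end Literature.Geometry.Lorentzian

end
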